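import Literature.AlgebraicGeometry.Morphisms.AffinePointsOverSpec
import Literature.AlgebraicGeometry.Morphisms.FiniteBaseChangeAffine
import HarnessLib

/-!
# Points of a finite cover over a point of the base, as ring maps out of the fibre algebra — with prescribed specialisation
# ([StacksProject] Tag 01I1, Tag 01WG; the row (L2c) of the (S-γ2) dictionary)

Topic `Literature/AlgebraicGeometry/Morphisms`.  THEOREMS only (no def, no instance, no notation, no named fact, no `sorry`).  Cell `hodgecm-mathlib`
(D-0151), FLOOR 0, programme F0P5a, crux item stmt-HodgeConjecture-24832 — (S-γ2) row (L2c) (F0P5a-p02 step list 2026-08-31, LEAD WORDS #11/#12,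
MOD-PLAN L5.5a), over ★ p799848 (`AffinePointsOverSpec`, B-p15) and ★ p799830 (`FiniteBaseChangeAffine`, F0P5a-p05).

For a FINITE morphism `g : Y ⟶ Z`, a ring `R` (in `CommRingCat`) and a point `s : Spec R ⟶ Z` of the base, write `P := pullback g s`
(an AFFINE scheme, ★ `isAffine_pullback`), `snd : P ⟶ Spec R`, and `φ := (ΓSpecIso R).inv ≫ snd.appTop : R ⟶ Γ(P, ⊤)` (a finite ring map).
For any `S` and `h : R ⟶ S` the `S`-points of `Y` OVER `s ∘ Spec h` are the ring maps `Γ(P, ⊤) ⟶ S` under `h`: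

* `bijective_appTop_lift` — `r ↦ (pullback.lift r (Spec.map h)).appTop ≫ (ΓSpecIso S).hom` is a bijection
  `{r : Spec S ⟶ Y // r ≫ g = Spec.map h ≫ s} → {ψ : Γ(P, ⊤) ⟶ S // φ ≫ ψ = h}` (pullback universal property + ★ `bijective_appTop_comp_ΓSpecIso_hom_over`);
* `appTop_lift_naturality` — it is NATURAL in `S`: the point `Spec.map u ≫ r` over `Spec.map (h ≫ u) ≫ s` goes to `ψ ≫ u`;
* **`card_points_specialising_eq`** — hence, for `u : S ⟶ S'` and a point `r'` of `Y` over `Spec.map (h ≫ u) ≫ s` with ring map `ψ'`, the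
  points `r` over `Spec.map h ≫ s` SPECIALISING to `r'` (`Spec.map u ≫ r = r'`) correspond bijectively to the ring maps `ψ` under `h` with
  `ψ ≫ u = ψ'` — and the two `Nat.card`s agree.  (Case of record: `S = R` the valuation ring of a geometric point, `h = 𝟙`, `S' = κ(R)`,
  `u = residue`: integral points with prescribed reduction ↔ sections of the fibre algebra with prescribed residue.)

HC_CM is proved only modulo the 7 printed citations until rung 0 closes; this file is a generic leaf and changes no count.

## References
* [StacksProject] The Stacks Project, Tag 01I1 (morphisms into an affine scheme), Tag 01WG (finite morphisms are affine).
-/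

set_option autoImplicit false

noncomputable section

universe u

open CategoryTheory CategoryTheory.Limits AlgebraicGeometry

namespace Literature.AlgebraicGeometry.Morphisms

variable {Y Z : Scheme.{u}} (g : Y ⟶ Z) [IsFinite g] {R : CommRingCat.{u}} (s : Spec R ⟶ Z)

omit [IsFinite g] in
/-- A point `r` of `Y` over `Spec.map h ≫ s` defines a point of the pullback over `Spec.map h`. [cite: StacksProject, Tag 01I1] -/
theorem lift_comp_snd {S : CommRingCat.{u}} (h : R ⟶ S) (r : Spec S ⟶ Y) (hr : r ≫ g = Spec.map h ≫ s) :
    pullback.lift r (Spec.map h) hr ≫ pullback.snd g s = Spec.map h :=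
  pullback.lift_snd _ _ _

omit [IsFinite g] in
/-- **Points over `s` = points of the pullback**: `r ↦ pullback.lift r (Spec.map h)` is a bijection from the `S`-points of `Y` over
`Spec.map h ≫ s` onto the `S`-points of `P = pullback g s` over `Spec.map h` (inverse: compose with `pullback.fst`). [cite: StacksProject, Tag 01I1] -/
theorem bijective_lift {S : CommRingCat.{u}} (h : R ⟶ S) :
    Function.Bijective (fun r : {r : Spec S ⟶ Y // r ≫ g = Spec.map h ≫ s} =>
      (⟨pullback.lift r.1 (Spec.map h) r.2, lift_comp_snd g s h r.1 r.2⟩ :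
        {t : Spec S ⟶ pullback g s // t ≫ pullback.snd g s = Spec.map h})) := by
  refine ⟨fun r r' hrr' => ?_, fun t => ?_⟩
  · apply Subtype.ext
    have := congrArg (fun t : {t : Spec S ⟶ pullback g s // t ≫ pullback.snd g s = Spec.map h} => t.1 ≫ pullback.fst g s) hrr'
    simpa only [pullback.lift_fst] using this
  · refine ⟨⟨t.1 ≫ pullback.fst g s, by rw [Category.assoc, pullback.condition, ← Category.assoc, t.2]⟩, Subtype.ext ?_⟩
    apply pullback.hom_ext
    · rw [pullback.lift_fst]
    · rw [pullback.lift_snd, t.2]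

/-- **`S`-points of `Y` over `s` = ring maps `Γ(P, ⊤) ⟶ S` under `h`**: the composite `r ↦ (pullback.lift r (Spec.map h)).appTop ≫ (ΓSpecIso S).hom`
is a bijection `{r : Spec S ⟶ Y // r ≫ g = Spec.map h ≫ s} → {ψ : Γ(P, ⊤) ⟶ S // φ ≫ ψ = h}` (★ `bijective_appTop_comp_ΓSpecIso_hom_over` for the
affine `P`). [cite: StacksProject, Tag 01I1] [cite: StacksProject, Tag 01WG] -/
theorem bijective_appTop_lift {S : CommRingCat.{u}} (h : R ⟶ S) :
    Function.Bijective (fun r : {r : Spec S ⟶ Y // r ≫ g = Spec.map h ≫ s} =>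
      (⟨(pullback.lift r.1 (Spec.map h) r.2).appTop ≫ (Scheme.ΓSpecIso S).hom,
          (comp_eq_specMap_iff (pullback.snd g s) h _).1 (lift_comp_snd g s h r.1 r.2)⟩ :
        {ψ : Γ(pullback g s, ⊤) ⟶ S // (Scheme.ΓSpecIso R).inv ≫ (pullback.snd g s).appTop ≫ ψ = h})) := by
  haveI : IsAffine (pullback g s) := isAffine_pullback g s
  exact (bijective_appTop_comp_ΓSpecIso_hom_over (pullback.snd g s) h).comp (bijective_lift g s h)

omit [IsFinite g] in
/-- **Naturality in `S`**: for `u : S ⟶ S'` and a point `r` over `Spec.map h ≫ s`, the point `Spec.map u ≫ r` (over `Spec.map (h ≫ u) ≫ s`) has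
ring map `ψ ≫ u`, `ψ` the ring map of `r`. [cite: StacksProject, Tag 01I1] -/
theorem appTop_lift_naturality {S S' : CommRingCat.{u}} (h : R ⟶ S) (u : S ⟶ S') (r : Spec S ⟶ Y) (hr : r ≫ g = Spec.map h ≫ s)
    (hr' : (Spec.map u ≫ r) ≫ g = Spec.map (h ≫ u) ≫ s) :
    (pullback.lift (Spec.map u ≫ r) (Spec.map (h ≫ u)) hr').appTop ≫ (Scheme.ΓSpecIso S').hom =
      ((pullback.lift r (Spec.map h) hr).appTop ≫ (Scheme.ΓSpecIso S).hom) ≫ u := by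
  have hl : pullback.lift (Spec.map u ≫ r) (Spec.map (h ≫ u)) hr' = Spec.map u ≫ pullback.lift r (Spec.map h) hr := by
    apply pullback.hom_ext
    · rw [pullback.lift_fst, Category.assoc, pullback.lift_fst]
    · rw [pullback.lift_snd, Category.assoc, pullback.lift_snd, Spec.map_comp]
  rw [hl, Scheme.Hom.comp_appTop, Category.assoc, Scheme.ΓSpecIso_naturality, Category.assoc]

/-- **Points with prescribed specialisation ↔ ring maps with prescribed composite.**  For `u : S ⟶ S'`, a point `r'` of `Y` over
`Spec.map (h ≫ u) ≫ s` with ring map `ψ' = (pullback.lift r' _).appTop ≫ (ΓSpecIso S').hom`, the points `r` over `Spec.map h ≫ s` SPECIALISING to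
`r'` (`Spec.map u ≫ r = r'`) are equinumerous with the ring maps `ψ` under `h` with `ψ ≫ u = ψ'` (`r ↦ ψ_r` restricts to a bijection: naturality +
injectivity at `S'`). [cite: StacksProject, Tag 01I1] [cite: StacksProject, Tag 01WG] -/
theorem card_points_specialising_eq {S S' : CommRingCat.{u}} (h : R ⟶ S) (u : S ⟶ S') (r' : Spec S' ⟶ Y)
    (hr' : r' ≫ g = Spec.map (h ≫ u) ≫ s) :
    Nat.card {r : Spec S ⟶ Y // r ≫ g = Spec.map h ≫ s ∧ Spec.map u ≫ r = r'} =
      Nat.card {ψ : Γ(pullback g s, ⊤) ⟶ S // (Scheme.ΓSpecIso R).inv ≫ (pullback.snd g s).appTop ≫ ψ = h ∧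
        ψ ≫ u = (pullback.lift r' (Spec.map (h ≫ u)) hr').appTop ≫ (Scheme.ΓSpecIso S').hom} := by
  let Φ := Equiv.ofBijective _ (bijective_appTop_lift g s h)
  let Φ' := Equiv.ofBijective _ (bijective_appTop_lift g s (h ≫ u))
  -- a point `r` over `Spec.map h ≫ s` pushes to the point `Spec.map u ≫ r` over `Spec.map (h ≫ u) ≫ s`, with ring map `ψ_r ≫ u`
  have hover : ∀ r : {r : Spec S ⟶ Y // r ≫ g = Spec.map h ≫ s}, (Spec.map u ≫ r.1) ≫ g = Spec.map (h ≫ u) ≫ s := fun r => by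
    rw [Category.assoc, r.2, ← Category.assoc, ← Spec.map_comp]
  have hnat : ∀ r : {r : Spec S ⟶ Y // r ≫ g = Spec.map h ≫ s}, (Φ' ⟨Spec.map u ≫ r.1, hover r⟩).1 = (Φ r).1 ≫ u := fun r =>
    appTop_lift_naturality g s h u r.1 r.2 (hover r)
  have key : ∀ r : {r : Spec S ⟶ Y // r ≫ g = Spec.map h ≫ s},
      Spec.map u ≫ r.1 = r' ↔ (Φ r).1 ≫ u = (pullback.lift r' (Spec.map (h ≫ u)) hr').appTop ≫ (Scheme.ΓSpecIso S').hom := by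
    intro r
    have e2 : (Φ' ⟨r', hr'⟩).1 = (pullback.lift r' (Spec.map (h ≫ u)) hr').appTop ≫ (Scheme.ΓSpecIso S').hom := rfl
    rw [← hnat r, ← e2]
    constructor
    · intro hru
      have : (⟨Spec.map u ≫ r.1, hover r⟩ : {r : Spec S' ⟶ Y // r ≫ g = Spec.map (h ≫ u) ≫ s}) = ⟨r', hr'⟩ := Subtype.ext hru
      rw [this]
    · intro hψ
      exact congrArg Subtype.val (Φ'.injective (Subtype.ext hψ))
  calc Nat.card {r : Spec S ⟶ Y // r ≫ g = Spec.map h ≫ s ∧ Spec.map u ≫ r = r'}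
      = Nat.card {r : {r : Spec S ⟶ Y // r ≫ g = Spec.map h ≫ s} // Spec.map u ≫ r.1 = r'} :=
        Nat.card_congr (Equiv.subtypeSubtypeEquivSubtypeInter (fun r : Spec S ⟶ Y => r ≫ g = Spec.map h ≫ s) _).symm
    _ = Nat.card {ψ : {ψ : Γ(pullback g s, ⊤) ⟶ S // (Scheme.ΓSpecIso R).inv ≫ (pullback.snd g s).appTop ≫ ψ = h} //
          ψ.1 ≫ u = (pullback.lift r' (Spec.map (h ≫ u)) hr').appTop ≫ (Scheme.ΓSpecIso S').hom} :=
        Nat.card_congr (Φ.subtypeEquiv key)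
    _ = _ := Nat.card_congr (Equiv.subtypeSubtypeEquivSubtypeInter
          (fun ψ : Γ(pullback g s, ⊤) ⟶ S => (Scheme.ΓSpecIso R).inv ≫ (pullback.snd g s).appTop ≫ ψ = h)
          (fun ψ : Γ(pullback g s, ⊤) ⟶ S => ψ ≫ u = (pullback.lift r' (Spec.map (h ≫ u)) hr').appTop ≫ (Scheme.ΓSpecIso S').hom))

/-! ### Sections of the structure map (with prescribed composite) ↔ algebra maps, for ANY compatible algebra structure
(appended 2026-08-31 for the (S-γ2) geometric assembly `Motives/FiniteFlatCoverReductionMultiset`: the consumer's `Algebra R Γ(P, ⊤)` need only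
satisfy `algebraMap = φ`; ★ `bijective_ofHom_algHom` / `card_algHom_eq_card_under` (FiniteBaseChangeAffine) restricted to sections and to a
prescribed composite `ψ ≫ u`, case of record `u = residue`) -/

section AlgHom

variable {A B : CommRingCat.{u}} (φ : A ⟶ B) [Algebra A B]

/-- **Sections of `φ : A ⟶ B` are the `A`-algebra maps `B →ₐ[A] A`**, for ANY algebra structure on `B` with `algebraMap = φ`
(★ `card_algHom_eq_card_under` with `S = A`, `algebraMap A A = 𝟙`). [cite: AtiyahMacdonald1969, Ch. 2 p. 30 (A-algebra homomorphisms)] -/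
theorem card_under_id_eq_card_algHom (halg : algebraMap A B = φ.hom) :
    Nat.card {ψ : B ⟶ A // φ ≫ ψ = 𝟙 A} = Nat.card (B →ₐ[A] A) := by
  have hinst : ‹Algebra A B› = φ.hom.toAlgebra := Algebra.algebra_ext _ _ fun r => by rw [halg]; rfl
  subst hinst
  letI := φ.hom.toAlgebra
  have h1 : CommRingCat.ofHom (algebraMap A A) = 𝟙 A := by rw [Algebra.algebraMap_self]; rfl
  rw [card_algHom_eq_card_under φ A, h1]
  rfl

/-- **Sections of `φ` with prescribed composite `ψ ≫ u = χ` are the algebra maps `g : B →ₐ[A] A` with `u ∘ g = χ`** (★ `bijective_ofHom_algHom`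
restricted; case of record: `u = residue`, `χ` the ring map of a point of the special fibre). [cite: AtiyahMacdonald1969, Ch. 2 p. 30 (A-algebra homomorphisms)] -/
theorem card_under_id_comp_eq_card_algHom (halg : algebraMap A B = φ.hom) {S' : Type u} [CommRing S'] (u : A →+* S')
    (χ : B ⟶ CommRingCat.of S') :
    Nat.card {ψ : B ⟶ A // φ ≫ ψ = 𝟙 A ∧ ψ ≫ CommRingCat.ofHom u = χ} =
      Nat.card {g : B →ₐ[A] A // u.comp (g : B →+* A) = χ.hom} := by
  have hinst : ‹Algebra A B› = φ.hom.toAlgebra := Algebra.algebra_ext _ _ fun r => by rw [halg]; rfl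
  subst hinst
  letI := φ.hom.toAlgebra
  have h1 : CommRingCat.ofHom (algebraMap A A) = 𝟙 A := by rw [Algebra.algebraMap_self]; rfl
  let Φ := Equiv.ofBijective _ (bijective_ofHom_algHom φ A)
  have key : ∀ g : B →ₐ[A] A, (Φ g).1 ≫ CommRingCat.ofHom u = χ ↔ u.comp (g : B →+* A) = χ.hom := fun g => by
    constructor
    · intro h; rw [← h]; rfl
    · intro h; apply CommRingCat.hom_ext; rw [← h]; rfl
  calc Nat.card {ψ : B ⟶ A // φ ≫ ψ = 𝟙 A ∧ ψ ≫ CommRingCat.ofHom u = χ}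
      = Nat.card {ψ : {ψ : B ⟶ CommRingCat.of A // φ ≫ ψ = CommRingCat.ofHom (algebraMap A A)} // ψ.1 ≫ CommRingCat.ofHom u = χ} := by
        rw [h1]
        exact Nat.card_congr (Equiv.subtypeSubtypeEquivSubtypeInter (fun ψ : B ⟶ A => φ ≫ ψ = 𝟙 A)
          (fun ψ => ψ ≫ CommRingCat.ofHom u = χ)).symm
    _ = Nat.card {g : B →ₐ[A] A // u.comp (g : B →+* A) = χ.hom} :=
        (Nat.card_congr (Φ.subtypeEquiv fun g => (key g).symm)).symm

end AlgHom

end Literature.AlgebraicGeometry.Morphisms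

end
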